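import Summits.QuantumFields.GaugeBoot.LatticeStokesRectangle
import Summits.QuantumFields.GaugeBoot.SUNWeakCouplingRate
import HarnessLib

/-!
# Lattice non-abelian Stokes, integrated: `1 − ⟨W̄(R×T)⟩ ≤ (RT)²(1 − ⟨ū_P⟩)` on every torus, and Wilson loops `1 − O((RT)² log β/β)` at weak coupling for every `L` (gauge-boot, ADDENDUM 23 part B)

HONEST FRAMING (cell `pub-gaugeboot`, page 1 of every file): the venture produces certified bounds
on lattice expectations at stated coupling, gauge group, dimension and torus size; NOT a mass gap,
NOT a continuum limit, NOT a string tension; NOT Yang–Mills-summit-bearing (barriers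
`FixedCouplingUltralocality`, `PerturbativeInvisibility`).  Analytic inequalities between lattice expectations, uniform in the
volume; the weak-coupling corollary is informative only for `β_std ≫ (RT)²`; no number of CERTIFIED.md is touched.

## Content

Integrating the pointwise lattice Stokes bound of `LatticeStokesRectangle` against a torus Wilson state (every plaquette has the
expectation of the mean plaquette; the `R × T` loop that of the mean loop — orbit averaging, `OrbitAverages`):

* ★★★ `one_sub_wilsonExpectation_meanWilsonLoop_le` — every compact `G`, continuous `ρ` (`N ≥ 1`), `d ≥ 2`, every `L`, every real
  `β`, every `R, T`: **`1 − ⟨W̄(R×T)⟩_{β,L} ≤ (RT)²·(1 − ⟨ū_P⟩_{β,L})`**;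
* ★★★ `one_sub_wilsonLoopExpectation_le` — the cell's form: **`1 − wilsonLoopExpectation N D L β_std R T ≤ (RT)²(1 − plaquetteExpectation N D L β_std)`**
  (`SU(N)`, `N ≥ 1`, `D ≥ 2`, EVERY `L`, EVERY real `β_std`, every `R, T`) — so every certified LOWER bound on the plaquette is a
  certified lower bound on every rectangular Wilson loop of the same torus;
* ★★★ `one_sub_wilsonLoopExpectation_le_weakCoupling` — with ADDENDUM 18's volume-uniform rate: for `β_std ≥ N`,
  `1 − wilsonLoopExpectation N D L β_std R T ≤ (RT)²·(2 + (4N²/(D−1))(log(144N²) + log(β_std/N)))/β_std` for EVERY torus side `L`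
  (`SU(3)`, `D = 4`: `(RT)²(2 + 12(log 1296 + log(β/3)))/β`).  ADDENDUM 21's `1 − O(RT/β)` holds at limit points only (reflection
  positivity); this finite-volume statement pays `(RT)²` for dispensing with RP.

References: K. G. Wilson, Phys. Rev. D 10 (1974); M. Creutz, *Quarks, gluons and lattices* (1983) Ch. 9–10.  Everything is
`[folklore]`.
-/

noncomputable section

open MeasureTheory
open Literature.MathematicalPhysics.QuantumFieldTheory
open Literature.RepresentationTheory.CompactGroups

namespace Summit.QuantumFields.GaugeBoot

namespace LatticeStokes

variable {d L N : ℕ} {G : Type*} [Group G] [TopologicalSpace G] [IsTopologicalGroup G] [CompactSpace G]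
  [MeasurableSpace G] [BorelSpace G] (ρ : G →* Matrix (Fin N) (Fin N) ℂ)

/-- ★★★ **Lattice Stokes, integrated**: for every compact `G`, continuous `N`-dimensional `ρ` with `N ≥ 1`, `d ≥ 2`, every torus
side `L`, every real `β` and every `R, T`: `1 − ⟨W̄(R×T)⟩_{β,L} ≤ (RT)²·(1 − ⟨ū_P⟩_{β,L})`. [folklore] -/
theorem one_sub_wilsonExpectation_meanWilsonLoop_le [NeZero L] (hρ : Continuous ρ) (hN : N ≠ 0) (hd : 2 ≤ d) (β : ℝ) (R T : ℕ) :
    1 - wilsonExpectation ρ β (meanWilsonLoop (d := d) (L := L) (G := G) ρ R T) ≤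
      ((R : ℝ) * T) ^ 2 * (1 - wilsonExpectation ρ β (meanPlaquette (d := d) (L := L) (G := G) ρ)) := by
  obtain ⟨i, j, hij⟩ : ∃ i j : Fin d, i ≠ j := ⟨⟨0, by omega⟩, ⟨1, by omega⟩, by simp [Fin.ext_iff]⟩
  haveI := isProbabilityMeasure_wilsonMeasure (d := d) (L := L) (G := G) ρ hρ β
  set x : Site d L := fun _ => 0
  set μW := wilsonMeasure (d := d) (L := L) (G := G) ρ β
  rw [wilsonExpectation_meanWilsonLoop_eq_wilsonLoop ρ hρ β R T x hij]
  -- `|W_{R×T}| ≤ 1` pointwise (as in `OrbitAverages`; the landed copy lives outside this module's import closure)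
  have hbd : ∀ U : GaugeConfig d L G, |wilsonLoop ρ x i j R T U| ≤ 1 := fun U => by
    unfold wilsonLoop
    have h := CompactGroup.abs_re_trace_le_card ρ hρ (rectangleHolonomy U x i j R T)
    rw [Fintype.card_fin] at h
    have hNpos : (0 : ℝ) < N := by exact_mod_cast Nat.pos_of_ne_zero hN
    rw [abs_mul, abs_inv, Nat.abs_cast]
    calc (N : ℝ)⁻¹ * |(ρ (rectangleHolonomy U x i j R T)).trace.re| ≤ (N : ℝ)⁻¹ * N := by gcongr
      _ = 1 := inv_mul_cancel₀ hNpos.ne'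
  have hiW : Integrable (wilsonLoop ρ x i j R T) μW :=
    Integrable.of_bound (StringTension.measurable_wilsonLoop ρ hρ _ _ _ R T).aestronglyMeasurable 1
      (ae_of_all _ fun U => by rw [Real.norm_eq_abs]; exact hbd U)
  have hiP : ∀ y : Site d L, Integrable (plaquetteTrace (G := G) ρ y i j) μW := fun y =>
    Integrable.of_bound (measurable_plaquetteTrace ρ hρ _ _ _).aestronglyMeasurable 1
      (ae_of_all _ fun U => by rw [Real.norm_eq_abs]; exact abs_plaquetteTrace_le_one ρ hρ _ _ _ U)
  -- integrate the pointwise bound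
  have hpt : ∀ U : GaugeConfig d L G, 1 - wilsonLoop ρ x i j R T U ≤
      (R : ℝ) * T * ∑ t ∈ Finset.range T, ∑ k ∈ Finset.range R,
        (1 - plaquetteTrace ρ (x + Pi.single i ((k : ℕ) : ZMod L) + Pi.single j ((t : ℕ) : ZMod L)) i j U) :=
    fun U => one_sub_wilsonLoop_le ρ hρ hN U x i j R T
  have hiPk : ∀ t k : ℕ, Integrable (fun U : GaugeConfig d L G =>
      1 - plaquetteTrace ρ (x + Pi.single i ((k : ℕ) : ZMod L) + Pi.single j ((t : ℕ) : ZMod L)) i j U) μW :=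
    fun t k => (integrable_const _).sub (hiP _)
  have hiS : ∀ t : ℕ, Integrable (fun U : GaugeConfig d L G => ∑ k ∈ Finset.range R,
      (1 - plaquetteTrace ρ (x + Pi.single i ((k : ℕ) : ZMod L) + Pi.single j ((t : ℕ) : ZMod L)) i j U)) μW :=
    fun t => integrable_finsetSum _ fun k _ => hiPk t k
  have hiR : Integrable (fun U : GaugeConfig d L G => (R : ℝ) * T * ∑ t ∈ Finset.range T, ∑ k ∈ Finset.range R,
      (1 - plaquetteTrace ρ (x + Pi.single i ((k : ℕ) : ZMod L) + Pi.single j ((t : ℕ) : ZMod L)) i j U)) μW :=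
    (integrable_finsetSum _ fun t _ => hiS t).const_mul _
  have hiL : Integrable (fun U : GaugeConfig d L G => 1 - wilsonLoop ρ x i j R T U) μW := (integrable_const _).sub hiW
  have hint := integral_mono hiL hiR hpt
  rw [integral_sub (integrable_const _) hiW, integral_const, probReal_univ, one_smul, integral_const_mul,
    integral_finsetSum _ fun t _ => hiS t] at hint
  have hinner : ∀ t ∈ Finset.range T, ∫ U, ∑ k ∈ Finset.range R,
      (1 - plaquetteTrace ρ (x + Pi.single i ((k : ℕ) : ZMod L) + Pi.single j ((t : ℕ) : ZMod L)) i j U) ∂μW =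
      ∑ _k ∈ Finset.range R, (1 - wilsonExpectation ρ β (meanPlaquette (d := d) (L := L) (G := G) ρ)) := fun t _ => by
    rw [integral_finsetSum _ fun k _ => hiPk t k]
    refine Finset.sum_congr rfl fun k _ => ?_
    rw [integral_sub (integrable_const _) (hiP _), integral_const, probReal_univ, one_smul,
      wilsonExpectation_meanPlaquette_eq_plaquetteTrace ρ hρ β (x + Pi.single i ((k : ℕ) : ZMod L) + Pi.single j ((t : ℕ) : ZMod L)) hij]
    rfl
  rw [Finset.sum_congr rfl hinner] at hint
  simp only [Finset.sum_const, Finset.card_range, nsmul_eq_mul] at hint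
  refine (le_of_eq rfl).trans (hint.trans (le_of_eq ?_))
  ring

/-- ★★★ **The cell's form**: for `SU(N)`, `N ≥ 1`, `D ≥ 2`, EVERY torus side `L`, EVERY real `β_std` and every `R, T`:
`1 − wilsonLoopExpectation N D L β_std R T ≤ (RT)²·(1 − plaquetteExpectation N D L β_std)`. [folklore] -/
theorem one_sub_wilsonLoopExpectation_le {N D L : ℕ} [NeZero L] (hN : N ≠ 0) (hD : 2 ≤ D) (β : ℝ) (R T : ℕ) :
    1 - wilsonLoopExpectation N D L β R T ≤ ((R : ℝ) * T) ^ 2 * (1 - plaquetteExpectation N D L β) :=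
  one_sub_wilsonExpectation_meanWilsonLoop_le (suRep N) (continuous_suRep N) hN hD (β / N) R T

/-- ★★★ **Wilson loops at weak coupling on EVERY torus** (`SU(N)`, `N ≥ 1`, `D ≥ 2`, `β_std ≥ N`, every `L`, every `R, T`):
`1 − wilsonLoopExpectation N D L β_std R T ≤ (RT)²·(2 + (4N²/(D−1))(log(144N²) + log(β_std/N)))/β_std`. [folklore] -/
theorem one_sub_wilsonLoopExpectation_le_weakCoupling {N D L : ℕ} [NeZero L] (hN : N ≠ 0) (hD : 2 ≤ D) {β : ℝ}
    (hβ : (N : ℝ) ≤ β) (R T : ℕ) :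
    1 - wilsonLoopExpectation N D L β R T ≤
      ((R : ℝ) * T) ^ 2 * ((2 + 4 * (N : ℝ) ^ 2 / ((D : ℝ) - 1) * (Real.log (144 * (N : ℝ) ^ 2) + Real.log (β / N))) / β) :=
  (one_sub_wilsonLoopExpectation_le hN hD β R T).trans
    (mul_le_mul_of_nonneg_left (SUNRate.one_sub_plaquetteExpectation_le hN hD hβ) (by positivity))

/-- `SU(3)`, `D = 4`, `β_std ≥ 3`, every `L`, every `R, T`:
`1 − wilsonLoopExpectation 3 4 L β R T ≤ (RT)²·(2 + 12(log 1296 + log(β/3)))/β`. [folklore] -/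
theorem one_sub_wilsonLoopExpectation_three_four_le {L : ℕ} [NeZero L] {β : ℝ} (hβ : 3 ≤ β) (R T : ℕ) :
    1 - wilsonLoopExpectation 3 4 L β R T ≤ ((R : ℝ) * T) ^ 2 * ((2 + 12 * (Real.log 1296 + Real.log (β / 3))) / β) :=
  (one_sub_wilsonLoopExpectation_le (N := 3) (D := 4) (by norm_num) (by norm_num) β R T).trans
    (mul_le_mul_of_nonneg_left (SUNRate.one_sub_plaquetteExpectation_three_four_le hβ) (by positivity))

end LatticeStokes

end Summit.QuantumFields.GaugeBoot

end
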